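import Literature.GroupTheory.CombinatorialGroupTheory.RandomSclFreeGroupTokenAveraging
import Mathlib.GroupTheory.Perm.Cycle.Basic
import HarnessLib

/-!
# Random rigidity of scl (Calegari–Walker 2013): proofs, part 29 — token structures on a finite
type, linearised along the boundary cycle

D. Calegari, A. Walker, *Random rigidity in the free group*, Geom. Topol. 17 (2013)
[CalegariWalker2013], §4.4–4.7. The resolved boundary of a fatgraph is most naturally a finite
SET of sides (tokens) with the boundary successor permutation `S` (one cycle), the edge
involution `P`, lengths and starting positions. Parts 27–28 work with tokens indexed by
`0, …, Tn − 1` and `S = +1 (mod Tn)`; here we transport a structure given on a finite type along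
the enumeration `p ↦ S^p t₀` of the single `S`-cycle.

* **`linearize_tokens`** — from the structured axioms (consecutivity, involution, trivalence
  `P (S (P t)) = S⁻¹ (P (S⁻¹ t))`, word axiom) to the `ℕ`-indexed axioms of
  `comb_event_of_good` / `token_comb_inequality`, together with the transport of sums.
-/

noncomputable section

namespace Literature.GroupTheory.CombinatorialGroupTheory

section TokenLinearize

open Finset Equiv

open scoped Classical

set_option maxHeartbeats 800000 in
/-- **Linearisation of a token structure along its boundary cycle.** Let `S` be a permutation of
a finite type `T` which is one cycle on all of `T` (`IsCycleOn univ`), `t₀ : T`, and let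
`startT, lenT : T → ℕ`, `PT : T → T` satisfy: `startT t < N`, `startT (S t) ≡ startT t + lenT t`,
`PT` an involution preserving `lenT`, the trivalence axiom `PT (S (PT t)) = S⁻¹ (PT (S⁻¹ t))`, and
the word axiom. Then the functions `p ↦ startT (S^p t₀)`, `p ↦ lenT (S^p t₀)`,
`p ↦ idx (PT (S^p t₀))` satisfy the `ℕ`-indexed axioms of parts 27–28 with `Tn = |T|`, and sums
over `range |T|` of functions of the tokens are sums over `T`. [folklore] -/
theorem linearize_tokens {T : Type*} [Fintype T] (S : Equiv.Perm T)
    (hS : S.IsCycleOn ((Finset.univ : Finset T) : Set T)) (t₀ : T) {A : Type*} (inv : A → A)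
    (vg : ℕ → A) {N n' off : ℕ} (startT lenT : T → ℕ) (PT : T → T)
    (h1 : ∀ t, startT t < N) (h2 : ∀ t, startT (S t) = (startT t + lenT t) % N)
    (h3 : ∀ t, PT (PT t) = t) (h4 : ∀ t, lenT (PT t) = lenT t)
    (h5 : ∀ t, PT (S (PT t)) = S.symm (PT (S.symm t)))
    (h6 : ∀ t j, j < lenT t →
      vg (off + (startT (PT t) + j) % n') = inv (vg (off + (startT t + (lenT t - 1 - j)) % n'))) :
    ∃ (start len P : ℕ → ℕ) (e : ℕ → T),
      (∀ p, p < Fintype.card T → start p < N) ∧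
      (∀ p, p < Fintype.card T → start ((p + 1) % Fintype.card T) = (start p + len p) % N) ∧
      (∀ p, p < Fintype.card T → P p < Fintype.card T ∧ P (P p) = p) ∧
      (∀ p, p < Fintype.card T → len (P p) = len p) ∧
      (∀ p, p < Fintype.card T → P ((P p + 1) % Fintype.card T) =
        (P ((p + Fintype.card T - 1) % Fintype.card T) + Fintype.card T - 1) % Fintype.card T) ∧
      (∀ p, p < Fintype.card T → ∀ j, j < len p →
        vg (off + (start (P p) + j) % n') = inv (vg (off + (start p + (len p - 1 - j)) % n'))) ∧
      (∀ p, p < Fintype.card T → start p = startT (e p) ∧ len p = lenT (e p)) ∧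
      (∀ g : T → ℕ, ∑ p ∈ Finset.range (Fintype.card T), g (e p) = ∑ t, g t) := by
  set Tn := Fintype.card T with hTn
  have hTnpos : 0 < Tn := Fintype.card_pos_iff.mpr ⟨t₀⟩
  have hcardu : (Finset.univ : Finset T).card = Tn := Finset.card_univ
  -- the enumeration along the cycle
  set e : ℕ → T := fun p => (S ^ p) t₀ with he
  have hperiod : ∀ m n : ℕ, e m = e n ↔ m ≡ n [MOD Tn] := by
    intro m n
    simp only [he]
    rw [← hcardu]
    exact hS.pow_apply_eq_pow_apply (Finset.mem_univ t₀)
  -- every token is reached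
  have hex : ∀ t : T, ∃ k, e k = t := by
    intro t
    have hsc : S.SameCycle t₀ t := hS.2 (Finset.mem_univ t₀) (Finset.mem_univ t)
    obtain ⟨i, _, hi⟩ := hsc.exists_pow_eq'
    exact ⟨i, hi⟩
  set idx : T → ℕ := fun t => Nat.find (hex t) % Tn with hidx
  have hidx_lt : ∀ t, idx t < Tn := fun t => Nat.mod_lt _ hTnpos
  have he_idx : ∀ t, e (idx t) = t := by
    intro t
    have h := Nat.find_spec (hex t)
    simp only [hidx]
    rw [← h, hperiod, h]
    exact Nat.mod_modEq _ _
  have hidx_e : ∀ p, p < Tn → idx (e p) = p := by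
    intro p hp
    have h := he_idx (e p)
    rw [hperiod] at h
    rw [Nat.ModEq, Nat.mod_eq_of_lt (hidx_lt _), Nat.mod_eq_of_lt hp] at h
    exact h
  have he_mod : ∀ m, e (m % Tn) = e m := by
    intro m; rw [hperiod]; exact Nat.mod_modEq _ _
  have he_succ : ∀ m, e (m + 1) = S (e m) := by
    intro m; simp only [he, pow_succ', Equiv.Perm.mul_apply]
  have he_pred : ∀ m, e (m + Tn - 1) = S.symm (e m) := by
    intro m
    apply S.injective
    rw [Equiv.apply_symm_apply, ← he_succ, show m + Tn - 1 + 1 = m + Tn by omega, hperiod]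
    exact Nat.add_modEq_right
  -- the linearised data
  set start : ℕ → ℕ := fun p => startT (e p) with hstart
  set len : ℕ → ℕ := fun p => lenT (e p) with hlen
  set P : ℕ → ℕ := fun p => idx (PT (e p)) with hP
  refine ⟨start, len, P, e, ?_, ?_, ?_, ?_, ?_, ?_, ?_, ?_⟩
  · intro p _; exact h1 _
  · intro p _
    simp only [hstart, hlen]
    rw [he_mod, he_succ, h2]
  · intro p hp
    refine ⟨hidx_lt _, ?_⟩
    simp only [hP]
    rw [he_idx, h3, hidx_e p hp]
  · intro p _
    simp only [hlen, hP]
    rw [he_idx, h4]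
  · intro p hp
    simp only [hP]
    -- left: `idx (PT (e ((idx (PT (e p)) + 1) % Tn))) = idx (PT (S (PT (e p))))`
    rw [he_mod, he_succ, he_idx, h5]
    -- right: the index of `S⁻¹ (PT (S⁻¹ (e p)))`
    rw [he_mod, he_pred]
    have key : e ((idx (PT (S.symm (e p))) + Tn - 1) % Tn) = S.symm (PT (S.symm (e p))) := by
      rw [he_mod, he_pred, he_idx]
    have := hidx_e ((idx (PT (S.symm (e p))) + Tn - 1) % Tn) (Nat.mod_lt _ hTnpos)
    rw [key] at this
    exact this
  · intro p _ j hj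
    simp only [hstart, hlen, hP] at hj ⊢
    rw [he_idx]
    exact h6 _ j hj
  · intro p _; exact ⟨rfl, rfl⟩
  · intro g
    apply Finset.sum_nbij' e idx
    · intro p _; exact Finset.mem_univ _
    · intro t _; exact Finset.mem_range.mpr (hidx_lt t)
    · intro p hp; exact hidx_e p (Finset.mem_range.mp hp)
    · intro t _; exact he_idx t
    · intro p _; rfl

end TokenLinearize

end Literature.GroupTheory.CombinatorialGroupTheory

end
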